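import Literature.Topology.FourManifolds.Isotopy
import Literature.Topology.FourManifolds.ClosedBallProofs
import Mathlib.Analysis.SpecialFunctions.SmoothTransition
import HarnessLib

/-!
# Discharges for `Isotopy.lean`: ambient isotopy is an equivalence relation; ambient ⇒ smooth

Sorry-free proofs of three named facts of `Isotopy.lean` (Hirsch, *Differential Topology*
(1976), Ch. 8 §1, p. 178: "isotopy and ambient isotopy are equivalence relations"; "if `F` is
an ambient isotopy and `f` an embedding then `t ↦ F_t ∘ f` is an isotopy of `f`"):

* `Literature.Topology.FourManifolds.IsAmbientIsotopic.trans_holds` — discharge of `IsAmbientIsotopic.trans`: compose the two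
  ambient isotopies stagewise, `K_t = G_t ∘ F_t` (each stage is the diffeomorphism
  `(F.toDiffeomorph t).trans (G.toDiffeomorph t)`);
* `Literature.Topology.FourManifolds.equivalence_isAmbientIsotopic_holds` — discharge of `equivalence_isAmbientIsotopic`
  (with `isAmbientIsotopic_refl` and the tree's `IsAmbientIsotopic.symm_holds`);
* `Literature.Topology.FourManifolds.IsAmbientIsotopic.isSmoothlyIsotopic_holds` — discharge of
  `IsAmbientIsotopic.isSmoothlyIsotopic`: `t ↦ F_t ∘ f` is a smooth isotopy, each stage being a
  smooth embedding by `Manifold.IsSmoothEmbedding.diffeomorph_comp` (`ClosedBallProofs.lean`,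
  the postcomposition case of Mathlib's `proof_wanted IsSmoothEmbedding.comp`);
* `Literature.Topology.FourManifolds.SmoothIsotopy.trans` (real definition: concatenation of two smooth isotopies after
  reparametrising each to be stationary near the junction, with `Real.smoothTransition`) and the
  discharges `Literature.Topology.FourManifolds.IsSmoothlyIsotopic.trans_holds`, `Literature.Topology.FourManifolds.equivalence_isSmoothlyIsotopic_holds`,
  `Literature.Topology.FourManifolds.Diffeomorph.IsIsotopic.trans_holds`, `Literature.Topology.FourManifolds.Diffeomorph.IsotopyClass.mk_eq_mk_iff_holds`
  (Hirsch (1976), Ch. 8 §1, Exercise 1 / proof of Thm. 8.1.5, as cited in `Isotopy.lean`).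

## References

* M. W. Hirsch, *Differential Topology*, GTM 33, Springer (1976), Ch. 8 §1, p. 178.
-/

open scoped Manifold ContDiff Topology
open Function Set

noncomputable section

namespace Literature.Topology.FourManifolds

variable {EM HM EN HN : Type*} [NormedAddCommGroup EM] [NormedSpace ℝ EM] [TopologicalSpace HM]
  [NormedAddCommGroup EN] [NormedSpace ℝ EN] [TopologicalSpace HN]
  {I : ModelWithCorners ℝ EM HM} {J : ModelWithCorners ℝ EN HN}
  {N : Type*} [TopologicalSpace N] [ChartedSpace HN N]

namespace AmbientIsotopy

/-- **Stagewise composition of ambient isotopies**: `(F.comp G) _t = G_t ∘ F_t`, an ambient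
isotopy from `id` whose stage `1` is `G_1 ∘ F_1`. Each stage is the diffeomorphism
`(F.toDiffeomorph t).trans (G.toDiffeomorph t)` (whence bijective and a local diffeomorphism);
joint smoothness is that of `uncurry G` composed with the smooth map `(t, x) ↦ (t, F_t x)`.
Hirsch (1976), Ch. 8 §1, p. 178. [cite: HirschDT1976, Ch. 8 §1, p. 178] -/
def comp (F G : AmbientIsotopy J N) : AmbientIsotopy J N where
  toFun t := ⇑((F.toDiffeomorph t).trans (G.toDiffeomorph t))
  contMDiff := G.contMDiff.comp (contMDiff_fst.prodMk F.contMDiff)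
  bijective t := ((F.toDiffeomorph t).trans (G.toDiffeomorph t)).bijective
  isLocalDiffeomorph t := ((F.toDiffeomorph t).trans (G.toDiffeomorph t)).isLocalDiffeomorph
  map_zero := by
    funext x
    change G.toFun 0 (F.toFun 0 x) = x
    rw [F.map_zero, G.map_zero]
    rfl

/-- Stages of the stagewise composition. [folklore] -/
@[simp]
theorem comp_toFun (F G : AmbientIsotopy J N) (t : ℝ) :
    (F.comp G).toFun t = G.toFun t ∘ F.toFun t := rfl

end AmbientIsotopy

/-- **Discharge** of `IsAmbientIsotopic.trans`: ambient isotopy is transitive. If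
`g = F_1 ∘ f` and `h = G_1 ∘ g` then `h = (G_1 ∘ F_1) ∘ f = (F.comp G)_1 ∘ f`. The `IsManifold`
hypothesis of the fact is not used. Hirsch, *Differential Topology* (1976), Ch. 8 §1, p. 178.
[cite: HirschDT1976, Ch. 8 §1, p. 178] -/
theorem IsAmbientIsotopic.trans_holds {X : Type*} {f g h : X → N} :
    IsAmbientIsotopic.trans (I := I) (J := J) (f := f) (g := g) (h := h) := by
  intro _ hfg hgh
  obtain ⟨F, rfl⟩ := hfg
  obtain ⟨G, rfl⟩ := hgh
  exact ⟨F.comp G, rfl⟩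

variable (I J N) in
/-- **Discharge** of `equivalence_isAmbientIsotopic`: ambient isotopy is an equivalence relation
on all maps `X → N` (reflexive: trivial isotopy; symmetric: `IsAmbientIsotopic.symm_holds`,
reversed isotopy; transitive: `IsAmbientIsotopic.trans_holds`, stagewise composition).
Hirsch, *Differential Topology* (1976), Ch. 8 §1, p. 178. [cite: HirschDT1976, Ch. 8 §1, p. 178] -/
theorem equivalence_isAmbientIsotopic_holds (X : Type*) :
    equivalence_isAmbientIsotopic I J N X := by
  intro _
  exact ⟨isAmbientIsotopic_refl, fun h => IsAmbientIsotopic.symm_holds h,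
    fun h₁ h₂ => IsAmbientIsotopic.trans_holds h₁ h₂⟩

/-- **Discharge** of `IsAmbientIsotopic.isSmoothlyIsotopic`: ambient isotopic smooth embeddings
are smoothly isotopic — `t ↦ F_t ∘ f` is a smooth isotopy from `f` to `F_1 ∘ f`, each stage a
smooth embedding as the composition of the smooth embedding `f` with the diffeomorphism
`F.toDiffeomorph t` (`Manifold.IsSmoothEmbedding.diffeomorph_comp`, `ClosedBallProofs.lean`).
Hirsch, *Differential Topology* (1976), Ch. 8 §1, p. 178. [cite: HirschDT1976, Ch. 8 §1, p. 178] -/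
theorem IsAmbientIsotopic.isSmoothlyIsotopic_holds {M : Type*} [TopologicalSpace M]
    [ChartedSpace HM M] {f g : M → N} :
    IsAmbientIsotopic.isSmoothlyIsotopic (I := I) (J := J) (f := f) (g := g) := by
  intro _ hf hfg
  obtain ⟨F, rfl⟩ := hfg
  exact ⟨{ toFun := fun t => F.toFun t ∘ f
           contMDiff := F.contMDiff.comp (contMDiff_fst.prodMk (hf.contMDiff.comp contMDiff_snd))
           isSmoothEmbedding := fun t => hf.diffeomorph_comp (F.toDiffeomorph t)
           map_zero := by rw [F.map_zero, Function.id_comp]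
           map_one := rfl }⟩

/-! ### Concatenation of smooth isotopies -/

/-- First reparametrisation for concatenation: `μ t = smoothTransition (8t - 2)`, a smooth step
equal to `0` for `t ≤ 1/4` and to `1` for `t ≥ 3/8`. [folklore] -/
def concatStep₁ (t : ℝ) : ℝ :=
  Real.smoothTransition (8 * t - 2)

/-- Second reparametrisation for concatenation: `ν t = smoothTransition (8t - 5)`, a smooth
step equal to `0` for `t ≤ 5/8` and to `1` for `t ≥ 3/4`. [folklore] -/
def concatStep₂ (t : ℝ) : ℝ :=
  Real.smoothTransition (8 * t - 5)

/-- `concatStep₁` is smooth. [folklore] -/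
theorem contDiff_concatStep₁ : ContDiff ℝ ∞ concatStep₁ :=
  Real.smoothTransition.contDiff.comp ((contDiff_const.mul contDiff_id).sub contDiff_const)

/-- `concatStep₂` is smooth. [folklore] -/
theorem contDiff_concatStep₂ : ContDiff ℝ ∞ concatStep₂ :=
  Real.smoothTransition.contDiff.comp ((contDiff_const.mul contDiff_id).sub contDiff_const)

/-- `concatStep₁ 0 = 0`. [folklore] -/
@[simp]
theorem concatStep₁_zero : concatStep₁ 0 = 0 :=
  Real.smoothTransition.zero_of_nonpos (by norm_num)

/-- `concatStep₁ t = 1` for `t ≥ 3/8`. [folklore] -/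
theorem concatStep₁_of_ge {t : ℝ} (ht : 3 / 8 ≤ t) : concatStep₁ t = 1 :=
  Real.smoothTransition.one_of_one_le (by linarith)

/-- `concatStep₂ t = 0` for `t ≤ 5/8`. [folklore] -/
theorem concatStep₂_of_le {t : ℝ} (ht : t ≤ 5 / 8) : concatStep₂ t = 0 :=
  Real.smoothTransition.zero_of_nonpos (by linarith)

/-- `concatStep₂ 1 = 1`. [folklore] -/
@[simp]
theorem concatStep₂_one : concatStep₂ 1 = 1 :=
  Real.smoothTransition.one_of_one_le (by norm_num)

namespace SmoothIsotopy

variable {M : Type*} [TopologicalSpace M] [ChartedSpace HM M] {f g h : M → N}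

open Classical in
/-- **Concatenation of smooth isotopies.** Given smooth isotopies `F` from `f` to `g` and `G`
from `g` to `h`, run `F` reparametrised by `concatStep₁` on `t ≤ 1/2` and `G` reparametrised by
`concatStep₂` on `t ≥ 1/2`; both pieces are constant equal to `g` on the strip `3/8 < t < 5/8`,
so the concatenation is jointly `C^∞`. Hirsch (1976), Ch. 8 §1 (Exercise 1; proof of
Thm. 8.1.5). [cite: HirschDT1976, Ch. 8 §1] -/
def trans (F : SmoothIsotopy I J f g) (G : SmoothIsotopy I J g h) : SmoothIsotopy I J f h where
  toFun t := if t ≤ 1 / 2 then F.toFun (concatStep₁ t) else G.toFun (concatStep₂ t)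
  contMDiff := by
    -- the two smooth pieces
    have hA : ContMDiff (𝓘(ℝ, ℝ).prod I) J ∞ fun p : ℝ × M => F.toFun (concatStep₁ p.1) p.2 :=
      F.contMDiff.comp ((contDiff_concatStep₁.contMDiff.comp contMDiff_fst).prodMk contMDiff_snd)
    have hB : ContMDiff (𝓘(ℝ, ℝ).prod I) J ∞ fun p : ℝ × M => G.toFun (concatStep₂ p.1) p.2 :=
      G.contMDiff.comp ((contDiff_concatStep₂.contMDiff.comp contMDiff_fst).prodMk contMDiff_snd)
    -- they agree on the strip `3/8 < t < 5/8`
    have hAB : ∀ p : ℝ × M, 3 / 8 < p.1 → p.1 < 5 / 8 →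
        F.toFun (concatStep₁ p.1) p.2 = G.toFun (concatStep₂ p.1) p.2 := by
      intro p h1 h2
      rw [concatStep₁_of_ge h1.le, concatStep₂_of_le h2.le, F.map_one, G.map_zero]
    rintro ⟨t, x⟩
    by_cases ht : t < 5 / 8
    · refine hA.contMDiffAt.congr_of_eventuallyEq ?_
      have ho : IsOpen {p : ℝ × M | p.1 < 5 / 8} := isOpen_lt continuous_fst continuous_const
      filter_upwards [ho.mem_nhds (show ((t, x) : ℝ × M) ∈ {p : ℝ × M | p.1 < 5 / 8} from ht)]
        with p hp
      change (if p.1 ≤ 1 / 2 then F.toFun (concatStep₁ p.1)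
        else G.toFun (concatStep₂ p.1)) p.2 = _
      split_ifs with hle
      · rfl
      · exact (hAB p (by linarith [not_le.1 hle]) hp).symm
    · refine hB.contMDiffAt.congr_of_eventuallyEq ?_
      have ho : IsOpen {p : ℝ × M | 3 / 8 < p.1} := isOpen_lt continuous_const continuous_fst
      have ht' : (3 : ℝ) / 8 < t := by linarith [not_lt.1 ht]
      filter_upwards [ho.mem_nhds (show ((t, x) : ℝ × M) ∈ {p : ℝ × M | 3 / 8 < p.1} from ht')]
        with p hp
      change (if p.1 ≤ 1 / 2 then F.toFun (concatStep₁ p.1)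
        else G.toFun (concatStep₂ p.1)) p.2 = _
      split_ifs with hle
      · exact hAB p hp (by linarith)
      · rfl
  isSmoothEmbedding t := by
    split_ifs
    · exact F.isSmoothEmbedding _
    · exact G.isSmoothEmbedding _
  map_zero := by
    rw [if_pos (by norm_num), concatStep₁_zero, F.map_zero]
  map_one := by
    rw [if_neg (by norm_num), concatStep₂_one, G.map_one]

end SmoothIsotopy

/-- **Discharge** of `IsSmoothlyIsotopic.trans`: smooth isotopy is transitive (concatenate,
`SmoothIsotopy.trans`). Hirsch, *Differential Topology* (1976), Ch. 8 §1 (Exercise 1; proof of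
Thm. 8.1.5). [cite: HirschDT1976, Ch. 8 §1] -/
theorem IsSmoothlyIsotopic.trans_holds {M : Type*} [TopologicalSpace M] [ChartedSpace HM M]
    {f g h : M → N} :
    IsSmoothlyIsotopic.trans (I := I) (J := J) (f := f) (g := g) (h := h) := by
  rintro ⟨F⟩ ⟨G⟩
  exact ⟨F.trans G⟩

variable (I J N) in
/-- **Discharge** of `equivalence_isSmoothlyIsotopic`: smooth isotopy is an equivalence relation
on the smooth embeddings `M → N` (the interim proof of `Isotopy.lean`, now that transitivity is
proved). Hirsch, *Differential Topology* (1976), Ch. 8 §1. [cite: HirschDT1976, Ch. 8 §1] -/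
theorem equivalence_isSmoothlyIsotopic_holds (M : Type*) [TopologicalSpace M]
    [ChartedSpace HM M] : equivalence_isSmoothlyIsotopic I J (M := M) N :=
  ⟨fun f => .refl f.2, .symm, fun h₁ h₂ => IsSmoothlyIsotopic.trans_holds h₁ h₂⟩

/-- **Discharge** of `Diffeomorph.IsIsotopic.trans`: isotopy of self-diffeomorphisms is
transitive. Hirsch, *Differential Topology* (1976), Ch. 8 §1. [cite: HirschDT1976, Ch. 8 §1] -/
theorem Diffeomorph.IsIsotopic.trans_holds :
    Diffeomorph.IsIsotopic.trans (J := J) (N := N) :=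
  fun h₁ h₂ => IsSmoothlyIsotopic.trans_holds h₁ h₂

/-- **Discharge** of `Diffeomorph.IsotopyClass.mk_eq_mk_iff`: two diffeomorphisms of a `C^∞`
manifold have the same isotopy class iff they are isotopic (isotopy is an equivalence relation:
`Diffeomorph.IsIsotopic.refl_holds`, `.symm`, `.trans_holds`; the interim proof of
`Isotopy.lean`). [folklore] -/
theorem Diffeomorph.IsotopyClass.mk_eq_mk_iff_holds :
    Diffeomorph.IsotopyClass.mk_eq_mk_iff (J := J) (N := N) := by
  intro _ φ ψ
  have hE : Equivalence (Diffeomorph.IsIsotopic (J := J) (N := N)) :=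
    ⟨Diffeomorph.IsIsotopic.refl_holds, Diffeomorph.IsIsotopic.symm,
      fun h₁ h₂ => Diffeomorph.IsIsotopic.trans_holds h₁ h₂⟩
  refine ⟨fun hmk => ?_, fun hiso => Quot.sound hiso⟩
  exact hE.eqvGen_iff.mp (Quot.eqvGen_exact hmk)

end Literature.Topology.FourManifolds

end
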